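import Summits.PneNP.PneNP.Theses.SzkEntropy
import Literature.Computability.Complexity.PolynomialEntropyApproximation
import Literature.Computability.MetaComplexity.HeuristicClassesProofs

/-!
# PneNP / SzkEntropy — crux `PeaWorstToAvg` (stmt-PneNP-10777): the converse direction

Route `PneNP/SzkEntropy`, crux #3, item stmt-PneNP-10777 (`PeaWorstToAvg`):

  `PEA_3 ∉ PromiseBPP' → ∃ D samplable, supported on the promise, with ((PEA_3).yes, D) ∉ HeurBPP`

— worst-case hardness of cubic entropy approximation for randomized polynomial time should give
a polynomial-time samplable ensemble of promise instances on which no randomized heuristic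
scheme succeeds.  This is the OPEN programme "average-case hardness from the worst-case hardness
of `SZKP_L`" of Dvir–Gutfreund–Rothblum–Vadhan (ICS 2011, pp. 2–3); together with Ostrovsky's
theorem (hard-on-average SZK ⇒ one-way functions) a proof would base one-way functions on
`SZK_L ⊄ BPP`, a well-known open problem.  This file does not settle it.  It proves, over the
tree's definitions and without any hypothesis, the CONVERSE implication, so that the crux is
pinned down as exactly one half of an equivalence:

* `mem_HeurBPP_of_mem_PromiseBPP'` — for every DISJOINT promise problem `Q ∈ PromiseBPP'` and
  every ensemble `D` whose supports lie inside the promise, `(Q.yes, D) ∈ HeurBPP`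
  (Bogdanov–Trevisan's remark `(BPP, 𝒟) ⊆ HeurBPP`, §2.3, in its promise form: amplify the
  promise-BPP machine to coin error `≤ 1/8` on the promise by iterated majority-of-three —
  `exists_promise_error_le`, the pointwise form of the tree's `BPP_subset_bpErr` —, truncate
  the coins, ignore the scheme parameters `1ⁿ, 1ᵐ`; then no input of the support is bad, so the
  bad set has `Dₙ`-probability `0`);
* `szkEntropy_peaWorstToAvg_converse` — hence average-case hardness of `PEA_3` on ANY
  promise-supported ensemble gives `PEA_3 ∉ PromiseBPP'`;
* `szkEntropy_peaWorstToAvg_iff_iff` — so `PeaWorstToAvg` is EQUIVALENT to the biconditional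
  "`PEA_3 ∉ PromiseBPP'` iff some samplable promise-supported ensemble makes `(PEA_3).yes`
  `HeurBPP`-hard";
* `szkEntropy_peaWorstToAvg_iff` — the route's inline spelling is definitionally the statement
  about the library's `Literature.Computability.Complexity.PEA 3`;
* `szkEntropy_peaWorstToAvg_of_peaThreeMemBPP` — the kill switch `PeaThreeMemBPP`
  (`PEA_3 ∈ PromiseBPP'`) settles the crux vacuously.

The converse was also obtained, independently and slightly earlier (2026-08-15T22:25Z), by the
standing disprover `refuter-cdisprove-stmt-PneNP-10777-0` (item evidence `Disproof.lean` §2 and the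
candidate support file `Negative.lean`, which refuters cannot land under `Theorems/`); this file is
the prover-landed version of that support content (same statements, own proofs).

References: A. Bogdanov, L. Trevisan, *Average-Case Complexity*, FnT-TCS 2 (2006), §2.3 and
Def. 2.12–2.13; S. Arora, B. Barak, *Computational Complexity* (2009), Thm. 7.10;
Z. Dvir, D. Gutfreund, G. N. Rothblum, S. Vadhan, *On approximating the entropy of polynomial
mappings*, ICS 2011 (ECCC TR10-160), pp. 2–3; R. Ostrovsky, *One-way functions, hard on average
problems, and statistical zero-knowledge proofs*, Structures 1991.
-/

namespace Summit.PneNP.PneNP.Theorems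

open Literature.Computability.Complexity Literature.Computability.MetaComplexity
open _root_.Computability

/-! ### Error reduction for textbook promise-BPP, on the promise -/

/-- **Promise-BPP' has wrong-verdict probability `≤ 1/3` on the promise.** For a disjoint
`Q ∈ PromiseBPP'` with witness `L' ∈ P` and coin polynomial `p`, on every instance of the promise
the fraction of coin strings giving the wrong verdict about `x ∈ Q.yes` is at most `1/3`
(on a yes-instance the wrong event is `⟨x,y⟩ ∉ L'`, on a no-instance — which is not a
yes-instance, by disjointness — it is `⟨x,y⟩ ∈ L'`; complement rule `uniformProb_compl`).
[Goldreich2006, Def. 1.2 (promise-BPP); AroraBarakCC2009, Def. 7.3] -/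
theorem exists_promise_error_le_third {Q : PromiseProblem} (hQ : Q.Disjoint)
    (h : Q ∈ PromiseBPP') :
    ∃ L' ∈ Classes.P, ∃ p : Polynomial ℕ, ∀ x : List Bool, (x ∈ Q.yes ∨ x ∈ Q.no) →
      uniformProb (p.eval x.length) {y : List Bool | ¬ (boolPair x y ∈ L' ↔ x ∈ Q.yes)} ≤
        1 / 3 := by
  obtain ⟨L', hL', p, hyes, hno⟩ := h
  refine ⟨L', hL', p, fun x hx => ?_⟩
  rcases hx with hx | hx
  · have h1 := hyes x hx
    have hset : {y : List Bool | ¬ (boolPair x y ∈ L' ↔ x ∈ Q.yes)} =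
        {y : List Bool | boolPair x y ∈ L'}ᶜ := by
      ext y
      simp [hx]
    rw [hset, uniformProb_compl]
    linarith
  · have h1 := hno x hx
    have hx' : x ∉ Q.yes := fun h' => Set.disjoint_left.1 hQ h' hx
    have hset : {y : List Bool | ¬ (boolPair x y ∈ L' ↔ x ∈ Q.yes)} =
        {y : List Bool | boolPair x y ∉ L'}ᶜ := by
      ext y
      simp [hx']
    rw [hset, uniformProb_compl]
    linarith

/-- **One round of majority-of-three on the promise**: a witness with wrong-verdict probability
`≤ e ≤ 1` on every promise instance yields the witness `maj3Lang L' p ∈ P` (coin polynomial `3p`)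
with wrong-verdict probability `≤ e² (3 − 2e)` on every promise instance — the pointwise content
of the tree's `mem_bpErr_maj3` (`setOf_not_maj3Lang_iff`, `uniformProb_badTriples_le`).
[AroraBarakCC2009, Thm. 7.10 (three independent runs, majority)] -/
theorem promise_error_maj3 {Q : PromiseProblem} {e : ℝ} (he : e ≤ 1)
    (h : ∃ L' ∈ Classes.P, ∃ p : Polynomial ℕ, ∀ x : List Bool, (x ∈ Q.yes ∨ x ∈ Q.no) →
      uniformProb (p.eval x.length) {y : List Bool | ¬ (boolPair x y ∈ L' ↔ x ∈ Q.yes)} ≤ e) :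
    ∃ L' ∈ Classes.P, ∃ p : Polynomial ℕ, ∀ x : List Bool, (x ∈ Q.yes ∨ x ∈ Q.no) →
      uniformProb (p.eval x.length) {y : List Bool | ¬ (boolPair x y ∈ L' ↔ x ∈ Q.yes)} ≤
        e ^ 2 * (3 - 2 * e) := by
  obtain ⟨L', hL', p, hp⟩ := h
  refine ⟨maj3Lang L' p, maj3Lang_mem_P hL' p, 3 * p, fun x hx => ?_⟩
  have h3 : (3 * p : Polynomial ℕ).eval x.length =
      p.eval x.length + (p.eval x.length + p.eval x.length) := by
    simp
    ring
  rw [h3, setOf_not_maj3Lang_iff]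
  exact uniformProb_badTriples_le (hp x hx) he

/-- **All rounds**: a disjoint `Q ∈ PromiseBPP'` has, for every `k`, a witness in `P` with
wrong-verdict probability `≤ errSeq k` on every promise instance (`errSeq 0 = 1/3`,
`errSeq (k+1) = (errSeq k)² (3 − 2 errSeq k)`). [AroraBarakCC2009, Thm. 7.10] -/
theorem exists_promise_error_le_errSeq {Q : PromiseProblem} (hQ : Q.Disjoint)
    (h : Q ∈ PromiseBPP') (k : ℕ) :
    ∃ L' ∈ Classes.P, ∃ p : Polynomial ℕ, ∀ x : List Bool, (x ∈ Q.yes ∨ x ∈ Q.no) →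
      uniformProb (p.eval x.length) {y : List Bool | ¬ (boolPair x y ∈ L' ↔ x ∈ Q.yes)} ≤
        errSeq k := by
  induction k with
  | zero =>
    rw [errSeq]
    exact exists_promise_error_le_third hQ h
  | succ k ih =>
    rw [errSeq_succ]
    exact promise_error_maj3 (errSeq_mem_Icc k).2 ih

/-- **Promise-BPP' with any constant error on the promise**: a disjoint `Q ∈ PromiseBPP'` has,
for every `ε > 0`, a witness `L' ∈ P` and a coin polynomial with wrong-verdict probability `≤ ε`
on every instance of the promise (nothing is claimed off the promise).
[AroraBarakCC2009, §7.4.1 and Thm. 7.10; Goldreich2006, Def. 1.2] -/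
theorem exists_promise_error_le {Q : PromiseProblem} (hQ : Q.Disjoint) (h : Q ∈ PromiseBPP')
    {ε : ℝ} (hε : 0 < ε) :
    ∃ L' ∈ Classes.P, ∃ p : Polynomial ℕ, ∀ x : List Bool, (x ∈ Q.yes ∨ x ∈ Q.no) →
      uniformProb (p.eval x.length) {y : List Bool | ¬ (boolPair x y ∈ L' ↔ x ∈ Q.yes)} ≤ ε := by
  obtain ⟨k, hk⟩ := exists_errSeq_le hε
  obtain ⟨L', hL', p, hp⟩ := exists_promise_error_le_errSeq hQ h k
  exact ⟨L', hL', p, fun x hx => (hp x hx).trans hk⟩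

/-- **Machine form.** A disjoint `Q ∈ PromiseBPP'` has, for every `ε > 0`, a probabilistic
polynomial-time algorithm on strings with an exactly polynomial coin budget, coin-oblivious
(output determined by the first `coinLen |x|` coins), whose coin error about `x ∈ Q.yes` is
`≤ ε` on every instance of the promise: the coin-truncated witness algorithm
`(witnessAlg L' p).truncate id` of `exists_promise_error_le`.
[AroraBarakCC2009, Def. 7.3 and Thm. 7.10; Gill1977, Def. 5.2] -/
theorem exists_randAlg_promise_error_le {Q : PromiseProblem} (hQ : Q.Disjoint)
    (h : Q ∈ PromiseBPP') {ε : ℝ} (hε : 0 < ε) :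
    ∃ A : RandAlg (List Bool) Bool, A.IsPolyTime id encodeBool ∧
      (∃ q : Polynomial ℕ, ∀ n, A.coinLen n = q.eval n) ∧
      (∀ x r, A.run x r = A.run x (r.take (A.coinLen x.length))) ∧
      ∀ x : List Bool, (x ∈ Q.yes ∨ x ∈ Q.no) → A.pr id x {b | b ≠ Q.yes.boolIndicator x} ≤ ε := by
  obtain ⟨L', hL', p, hp⟩ := exists_promise_error_le hQ h hε
  refine ⟨(witnessAlg L' p).truncate id,
    (witnessAlg_isPolyTime hL' p).truncate polyTimeComputable_boolPair_take_holds ⟨p, fun _ => rfl⟩,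
    ⟨p, fun _ => rfl⟩, fun x r => ((witnessAlg L' p).truncate_run_take id x r).symm,
    fun x hx => ?_⟩
  rw [RandAlg.pr_truncate, witnessAlg_pr_ne]
  exact hp x hx

/-! ### Heuristic schemes from promise algorithms -/

/-- **No bad inputs on the support.** A coin-oblivious probabilistic polynomial-time decider
`A` with exactly polynomial coin budget and coin error `Pr_r[A(x, r) ≠ L(x)] < 1/4` on every
string of the SUPPORT of every `Dₙ` puts `(L, D)` in `HeurBPP`: the lift of `A` to scheme inputs
(ignore `1ⁿ, 1ᵐ`) has its set of bad inputs disjoint from `supp Dₙ`, hence of `Dₙ`-probability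
`0 ≤ 1/m`.  This is the support-relative form of the tree's `mem_HeurBPP_of_randAlg` (which asks
for the error bound on every string). [BogdanovTrevisan2006, §2.3 and Def. 2.12–2.13] -/
theorem mem_HeurBPP_of_randAlg_on_support {L : Language Bool} (D : Ensemble)
    (A : RandAlg (List Bool) Bool) (hA : A.IsPolyTime id encodeBool)
    (hq : ∃ q : Polynomial ℕ, ∀ n, A.coinLen n = q.eval n)
    (hobl : ∀ x r, A.run x r = A.run x (r.take (A.coinLen x.length)))
    (herr : ∀ n, ∀ x ∈ (D n).support, A.pr id x {b | b ≠ L.boolIndicator x} < 1 / 4) :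
    (⟨L, D⟩ : DistProblem) ∈ HeurBPP := by
  refine ⟨A.schemeLift, hA.schemeLift polyTimeComputable_schemeEnc_dropParams_holds,
    fun n m _ => ?_⟩
  have hdisj : Disjoint (D n).support
      {x | 1 / 4 ≤ A.schemeLift.pr schemeEnc (x, n, m) {b | b ≠ L.boolIndicator x}} := by
    refine Set.disjoint_left.2 fun x hx hbad => ?_
    rw [Set.mem_setOf_eq, A.pr_schemeLift hq hobl] at hbad
    exact absurd hbad (not_le.2 (herr n x hx))
  change D.prob n {x | 1 / 4 ≤ A.schemeLift.pr schemeEnc (x, n, m) {b | b ≠ L.boolIndicator x}} ≤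
    1 / m
  rw [Ensemble.prob, (PMF.toOuterMeasure_apply_eq_zero_iff _ _).2 hdisj, ENNReal.toReal_zero]
  positivity

/-- **Promise-`BPP'` problems are `HeurBPP`-easy on every promise-supported ensemble.** For a
disjoint promise problem `Q ∈ PromiseBPP'` and an ensemble `D` all of whose supports lie in the
promise `Q.yes ∪ Q.no`, the distributional problem `(Q.yes, D)` is in `HeurBPP` — amplify to coin
error `≤ 1/8 < 1/4` on the promise (`exists_randAlg_promise_error_le`) and apply
`mem_HeurBPP_of_randAlg_on_support`.  No samplability of `D` is needed.
[BogdanovTrevisan2006, §2.3 (a worst-case algorithm is a heuristic scheme with no bad inputs);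
Goldreich2006, Def. 1.2] -/
theorem mem_HeurBPP_of_mem_PromiseBPP' {Q : PromiseProblem} (hQ : Q.Disjoint)
    (h : Q ∈ PromiseBPP') (D : Ensemble)
    (hD : ∀ n : ℕ, ∀ w ∈ (D n).support, w ∈ Q.yes ∨ w ∈ Q.no) :
    (⟨Q.yes, D⟩ : DistProblem) ∈ HeurBPP := by
  obtain ⟨A, hA, hq, hobl, herr⟩ :=
    exists_randAlg_promise_error_le hQ h (by norm_num : (0 : ℝ) < 1 / 8)
  refine mem_HeurBPP_of_randAlg_on_support D A hA hq hobl fun n x hx => ?_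
  have := herr x (hD n x hx)
  linarith

/-! ### The crux `PeaWorstToAvg` -/

/-- **The route's crux over the library's `PEA 3`.** The inline `let ev/H/PEA := …` spelling of
`PeaWorstToAvg` (route SzkEntropy, item stmt-PneNP-10777) unfolds, definitionally, to the same
statement about `Literature.Computability.Complexity.PEA 3`.
[DvirGutfreundRothblumVadhan2010, §3 p. 6 (the promise problem PEA) and pp. 2–3 (the programme)] -/
theorem szkEntropy_peaWorstToAvg_iff :
    Summit.PneNP.PneNP.Theses.SzkEntropy.PeaWorstToAvg ↔
      (PEA 3 ∉ PromiseBPP' → ∃ D : Ensemble, D.IsPolySamplable ∧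
        (∀ n : ℕ, ∀ w ∈ (D n).support, w ∈ (PEA 3).yes ∨ w ∈ (PEA 3).no) ∧
        (⟨(PEA 3).yes, D⟩ : DistProblem) ∉ HeurBPP) :=
  Iff.rfl

/-- **The converse of the crux holds unconditionally**: if SOME ensemble supported on the promise
(samplable or not) makes `((PEA 3).yes, D)` `HeurBPP`-hard, then `PEA 3 ∉ PromiseBPP'`
(`mem_HeurBPP_of_mem_PromiseBPP'` with `PEA_disjoint`).  Average-case hardness of cubic entropy
approximation is at least as strong as its worst-case hardness; the crux asks for the reverse.
[BogdanovTrevisan2006, §2.3; DvirGutfreundRothblumVadhan2010, pp. 2–3] -/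
theorem szkEntropy_peaWorstToAvg_converse
    (h : ∃ D : Ensemble, D.IsPolySamplable ∧
      (∀ n : ℕ, ∀ w ∈ (D n).support, w ∈ (PEA 3).yes ∨ w ∈ (PEA 3).no) ∧
      (⟨(PEA 3).yes, D⟩ : DistProblem) ∉ HeurBPP) :
    PEA 3 ∉ PromiseBPP' := by
  intro hP
  obtain ⟨D, -, hD, hnot⟩ := h
  exact hnot (mem_HeurBPP_of_mem_PromiseBPP' (PEA_disjoint 3) hP D hD)

/-- **The crux is exactly a worst-case/average-case EQUIVALENCE for `PEA_3`.** `PeaWorstToAvg`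
holds iff: `PEA 3 ∉ PromiseBPP'` ⟺ some polynomial-time samplable ensemble supported on the
promise makes `((PEA 3).yes, D) ∉ HeurBPP` (the backward implication being
`szkEntropy_peaWorstToAvg_converse`). [DvirGutfreundRothblumVadhan2010, pp. 2–3;
BogdanovTrevisan2006, Def. 2.12–2.13] -/
theorem szkEntropy_peaWorstToAvg_iff_iff :
    Summit.PneNP.PneNP.Theses.SzkEntropy.PeaWorstToAvg ↔
      (PEA 3 ∉ PromiseBPP' ↔ ∃ D : Ensemble, D.IsPolySamplable ∧
        (∀ n : ℕ, ∀ w ∈ (D n).support, w ∈ (PEA 3).yes ∨ w ∈ (PEA 3).no) ∧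
        (⟨(PEA 3).yes, D⟩ : DistProblem) ∉ HeurBPP) := by
  rw [szkEntropy_peaWorstToAvg_iff]
  exact ⟨fun h => ⟨h, szkEntropy_peaWorstToAvg_converse⟩, fun h => h.1⟩

/-- **The kill switch settles the crux vacuously**: if `PEA 3 ∈ PromiseBPP'` (the route's
negative-side item `PeaThreeMemBPP`, i.e. `SZKP_L ⊆ prBPP`), the hypothesis of `PeaWorstToAvg`
fails and the crux holds. [DvirGutfreundRothblumVadhan2010, §4.4] -/
theorem szkEntropy_peaWorstToAvg_of_peaThreeMemBPP
    (h : Summit.PneNP.PneNP.Theses.SzkEntropy.PeaThreeMemBPP) :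
    Summit.PneNP.PneNP.Theses.SzkEntropy.PeaWorstToAvg :=
  szkEntropy_peaWorstToAvg_iff.2 fun hn => absurd (show PEA 3 ∈ PromiseBPP' from h) hn

end Summit.PneNP.PneNP.Theorems
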